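import Summits.QuantumFields.BalabanUV.T4Continuum.Support.NE7CriticalPairOfRoutePi
import Summits.QuantumFields.BalabanUV.T4Continuum.Support.NE7RoutePiRegimeSU2
import HarnessLib

/-!
# NE7CriticalPairSU2 — THE CRITICAL-PAIR END AT `d = 4`, `L = 2`, SU(2)∕U(2), `0 < ε ≤ 10⁻⁵³`: two TANGENT-CRITICAL admissible configurations on one fibre,
# represented by row NE3's route Π, are gauge equivalent — under EXACTLY the two k-free numeric lines of the ONE-STEP END of record (F31 ∕ F33), nothing else

Cell `pub-balaban`, rung (B)+1 sub-cell t4, lineage `b2b-balaban-t4-ne7-p1` (CRUX PROVER NE7 #1 = OWNER of row NE7), generation 87; memo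
`t4/b2b-balaban-t4-ne7-p1-g87/ROAD-B-IS-UNIQUENESS.md` §2.  File F236 (over F235 `NE7CriticalPairOfRoutePi`, F33 `NE7RoutePiRegimeSU2`, row NE3-R2's
`NE3ClassRadiusFamily.classSlicePoincare_SU2'`, F20 `NE7ConvOneStepSU2.levelSmall_all_d4_L2`).

WHY.  F235's END carries F31's uniform hypotheses verbatim.  At the sector `d = 4`, `L = 2`, `card n = 2`, `ε ≤ 10⁻⁵³` F31 ∕ F33 discharge all of them but the
ceilings and TWO k-free numeric lines (`ν̂ < 1`, the strict line); THIS FILE does the same for the critical-pair END, with the SAME two lines — so «the curved (APE) at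
a tangent-critical reference» costs NOTHING beyond what the ONE-STEP END of record already displays (and no Green's-function row).
WHAT ([folklore]; 0 def, 0 sorry).  **`gaugeAct_eq_of_tanCritical_pair_SU2`**, **`smallField_of_tanCritical_pair_SU2`** — F235 §2 with (P♮)_W (`classSlicePoincare_SU2'`,
constant `CPLine 4 2 2 10⁻¹⁷ 10⁻⁵³ + 1`), the level family (`levelSmall_all_d4_L2`), the W6 regime (`thetaLoc_mul_lt_one`) and `ε ≤ 1` DISCHARGED.
HONEST FRAMING (page 1): numeric specialisation; the per-pair representation data (row NE3's binder + the far quadratic letter) and the two lines are HYPOTHESES; NOT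
the a-priori estimate with gain, NOT ONE-STEP, NOT NE7; spine 0∕9; finite T⁴ rung (B)+1 — NOT infinite volume, NOT mass gap, NOT `BetaPertH`, NOT Clay.  Continuum
YM on T⁴ ⇐ BetaPertH ∧ nine spine estimates (0/9 proved); BetaPertH ⇐ (D1) ∧ (D4) ∧ CAP+tail; G-an2-4 gates asym, D1 and NE2/3/4.
-/

set_option autoImplicit false

open scoped BigOperators Matrix Matrix.Norms.L2Operator
open NormedSpace Finset Set

namespace Summit.QuantumFields.BalabanUV.T4Continuum.NE7CriticalPairSU2

open Literature.MathematicalPhysics.QuantumFieldTheory.Balaban1983to89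
open B7Prop1Explicit B7Prop2Explicit
open T4AveragingDeficitWall (IsUnitaryCfg IsSkewDir SmallField dirSq)
open T4AveragingDeficitWallBoundary (IsPeriodicCfg periodBox)
open AveragingDeficitPeriodicCounting (IsPeriodicDir)
open AveragingDeficitMultiLevelPrep (LevelSmall TangentIter)
open MinimalActionLevels (perWin)
open MinimalActionSandwich (admissible)
open MinimalActionRate (sfClass)
open NE3HessForm (dAction)
open NE3TangentCovariantTower (dirIter)
open NE3FrameFreeSliceW (frameFreeBlockLandauW)
open NE3SlicePoincareShape (SlicePoincare slicePoincare_mono)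
open NE3DecomposedRepOfLinearNormalPart (ResidualSliceRepT)
open NE3QbarIterCovLiftPrep (cruxC)
open NE3SmoothRightInverseW (rightInvW)
open NE3RightInverseSolveLetters (thetaLoc)
open NE3RightInverseL2Letter (l2C)
open NE3HatInvCurlLetters (curl2C curl1C)
open NE3SlicePoincareBudgetLine (CPLine)
open NE3ClassRadiusFamily (classSlicePoincare_SU2' CPLine_nonneg_d4_L2)
open NE7ConvOneStepSU2 (levelSmall_all_d4_L2)
open NE7RoutePiRegimeSU2 (thetaLoc_mul_lt_one)
open NE7CriticalPairOfRoutePi (gaugeAct_eq_of_tanCritical_pair_routePi smallField_of_tanCritical_pair_routePi)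

noncomputable section

variable {n : Type*} [Fintype n] [DecidableEq n]

set_option maxHeartbeats 400000 in
-- statement-level budget (the `hrep` binder), as in F31 ∕ F33
/-- **TWO TANGENT-CRITICAL ADMISSIBLE CONFIGURATIONS ON ONE FIBRE ARE GAUGE EQUIVALENT — `d = 4`, `L = 2`, SU(2)∕U(2) (`card n = 2`), `0 < ε ≤ 10⁻⁵³`, every level
`k+1`, every `N ≥ 1`**, from row NE3's route-Π data of the pair and the far quadratic letter; displayed uniform hypotheses: the ceilings `C₂, α̂, Ĉ` and F31's two
k-free lines. [folklore] -/
theorem gaugeAct_eq_of_tanCritical_pair_SU2 [Nonempty n] (hn : Fintype.card n = 2) {N : ℕ} [NeZero N] (hN : 1 ≤ N) (k : ℕ) {ε : ℝ}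
    (hε : 0 < ε) (hε' : ε ≤ 1 / 10 ^ 53) {C₂ αh Ch : ℝ} (hC₂ : 0 ≤ C₂) (hαh0 : 0 ≤ αh) (hαh1 : αh ≤ 1) (hCh0 : 0 ≤ Ch)
    {νh κh : ℝ} (hνh : νh = 2 * Real.sqrt (l2C 4 2 / (1 - thetaLoc 4 2 * ε) ^ 2 + curl2C 4 2 / (1 - thetaLoc 4 2 * ε) ^ 2) * C₂ * Ch * αh)
    (hκh : κh = 4 * (curl1C 4 2 / (1 - thetaLoc 4 2 * ε)) * C₂ * Ch ^ 2 * ε) (hν : νh < 1)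
    (hline : 2 * (κh / (1 - νh) ^ 2) < ((((1 / 2 - (νh / (1 - νh)) ^ 2) / (2 * (1 + (CPLine 4 2 2 (1 / 10 ^ 17) (1 / 10 ^ 53) + 1)))
        - (νh / (1 - νh)) ^ 2) / 2 - 576 * (4 : ℕ) * (αh ^ 2 * Real.exp (2 * αh))) / (Fintype.card n : ℝ) - 28 * (4 : ℕ) * (ε + 7 * αh ^ 2)))
    {V Us U' : Site 4 → Fin 4 → (Matrix n n ℂ)ˣ} (hmem : Us ∈ admissible (sfClass 4 2 N ε) 2 (k + 1) V)
    (hU' : U' ∈ admissible (sfClass 4 2 N ε) 2 (k + 1) V)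
    (hcritT : ∀ φ : Site 4 → Fin 4 → Matrix n n ℂ, IsSkewDir φ → IsPeriodicDir φ ((N * 2 ^ (k + 1) : ℕ) : ℤ) → TangentIter 2 k Us φ →
      dAction Us φ (perWin 4 (N * 2 ^ (k + 1))) = 0)
    (hcritU' : ∀ φ : Site 4 → Fin 4 → Matrix n n ℂ, IsSkewDir φ → IsPeriodicDir φ ((N * 2 ^ (k + 1) : ℕ) : ℤ) → TangentIter 2 k U' φ →
      dAction U' φ (perWin 4 (N * 2 ^ (k + 1))) = 0)
    {u : Site 4 → (Matrix n n ℂ)ˣ} {X₀ : Site 4 → Fin 4 → Matrix n n ℂ} {α₀ : ℝ} {m : Site 4 → Fin 4 → ℝ} {C : ℝ}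
    (hXs : IsSkewDir X₀)
    (hrep : ∀ (hWu : IsUnitaryCfg Us) (hx : 0 ≤ ε / ((((2 : ℕ) : ℝ)) ^ (k + 1)) ^ 2)
        (hs : LevelSmall 4 2 k (ε / ((((2 : ℕ) : ℝ)) ^ (k + 1)) ^ 2)) (hWx : SmallField Us (ε / ((((2 : ℕ) : ℝ)) ^ (k + 1)) ^ 2))
        (hθ : cruxC 4 2 * (((((2 : ℕ) : ℝ)) ^ (k + 1)) ^ 2 * (ε / ((((2 : ℕ) : ℝ)) ^ (k + 1)) ^ 2)) < 1)
        (hφ : IsSkewDir (dirIter 2 (k + 1) Us X₀)),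
      ResidualSliceRepT 2 N (k + 1) Us U' u X₀ (rightInvW (by norm_num) k hWu hx hs hWx N hθ hφ) α₀)
    (hm0 : ∀ z κ, 0 ≤ m z κ) (hC : 0 ≤ C)
    (hsq : ((((2 : ℕ) : ℝ)) ^ (k + 1)) ^ 4 * ∑ z ∈ periodBox (d := 4) N, ∑ κ : Fin 4, m z κ ^ 2
      ≤ C ^ 2 * dirSq X₀ (periodBox (d := 4) (N * 2 ^ (k + 1))))
    (hφq : ∀ z ∈ periodBox (d := 4) N, ∀ κ : Fin 4, ‖dirIter 2 (k + 1) Us X₀ z κ‖ ≤ C₂ * ((((2 : ℕ) : ℝ)) ^ (k + 1) * m z κ) ^ 2)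
    (hαh : α₀ * (((2 : ℕ) : ℝ)) ^ (k + 1) ≤ αh) (hmh : ∀ z κ, m z κ * (((2 : ℕ) : ℝ)) ^ (k + 1) ≤ αh) (hCh : C ≤ Ch)
    (hφq' : ∀ z ∈ periodBox (d := 4) N, ∀ κ : Fin 4, ‖dirIter 2 (k + 1) (gaugeAct u U') X₀ z κ‖ ≤ C₂ * ((((2 : ℕ) : ℝ)) ^ (k + 1) * m z κ) ^ 2) :
    gaugeAct u U' = Us := by
  have hP0 := classSlicePoincare_SU2' (n := n) hn hN hε hε'
  have hCP : 0 < CPLine 4 2 2 (1 / 10 ^ 17) (1 / 10 ^ 53) + 1 := by linarith [CPLine_nonneg_d4_L2]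
  have hP : ∀ (j : ℕ) (W : Site 4 → Fin 4 → (Matrix n n ℂ)ˣ), W ∈ sfClass 4 2 N ε (j + 1) →
      SlicePoincare 2 (j + 1) W (frameFreeBlockLandauW 2 N (j + 1) W) (CPLine 4 2 2 (1 / 10 ^ 17) (1 / 10 ^ 53) + 1)
        (periodBox (d := 4) (N * 2 ^ (j + 1))) :=
    fun j W hW => slicePoincare_mono (hP0 j W hW) (by linarith)
  have hls := levelSmall_all_d4_L2 hε.le (hε'.trans (by norm_num)) k
  have hε1 : ε ≤ 1 := hε'.trans (by norm_num)
  exact gaugeAct_eq_of_tanCritical_pair_routePi (d := 4) (by norm_num) k hε hls (thetaLoc_mul_lt_one hε hε') hε1 hC₂ hαh0 hαh1 hCh0 hCP hP hνh hκh hν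
    hline hmem hU' hcritT hcritU' hXs hrep hm0 hC hsq hφq hαh hmh hCh hφq'

set_option maxHeartbeats 400000 in
-- statement-level budget (the `hrep` binder), as in F31 ∕ F33
/-- **HENCE `SmallField U♯ r ⟹ SmallField U′ r`** at `d = 4`, `L = 2`, SU(2)∕U(2), `0 < ε ≤ 10⁻⁵³` — road (B)'s conclusion for a tangent-critical pair, exactly,
with no correction term and no Green's-function row, under F31's two k-free lines. [folklore] -/
theorem smallField_of_tanCritical_pair_SU2 [Nonempty n] (hn : Fintype.card n = 2) {N : ℕ} [NeZero N] (hN : 1 ≤ N) (k : ℕ) {ε : ℝ}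
    (hε : 0 < ε) (hε' : ε ≤ 1 / 10 ^ 53) {C₂ αh Ch : ℝ} (hC₂ : 0 ≤ C₂) (hαh0 : 0 ≤ αh) (hαh1 : αh ≤ 1) (hCh0 : 0 ≤ Ch)
    {νh κh : ℝ} (hνh : νh = 2 * Real.sqrt (l2C 4 2 / (1 - thetaLoc 4 2 * ε) ^ 2 + curl2C 4 2 / (1 - thetaLoc 4 2 * ε) ^ 2) * C₂ * Ch * αh)
    (hκh : κh = 4 * (curl1C 4 2 / (1 - thetaLoc 4 2 * ε)) * C₂ * Ch ^ 2 * ε) (hν : νh < 1)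
    (hline : 2 * (κh / (1 - νh) ^ 2) < ((((1 / 2 - (νh / (1 - νh)) ^ 2) / (2 * (1 + (CPLine 4 2 2 (1 / 10 ^ 17) (1 / 10 ^ 53) + 1)))
        - (νh / (1 - νh)) ^ 2) / 2 - 576 * (4 : ℕ) * (αh ^ 2 * Real.exp (2 * αh))) / (Fintype.card n : ℝ) - 28 * (4 : ℕ) * (ε + 7 * αh ^ 2)))
    {V Us U' : Site 4 → Fin 4 → (Matrix n n ℂ)ˣ} (hmem : Us ∈ admissible (sfClass 4 2 N ε) 2 (k + 1) V)
    (hU' : U' ∈ admissible (sfClass 4 2 N ε) 2 (k + 1) V)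
    (hcritT : ∀ φ : Site 4 → Fin 4 → Matrix n n ℂ, IsSkewDir φ → IsPeriodicDir φ ((N * 2 ^ (k + 1) : ℕ) : ℤ) → TangentIter 2 k Us φ →
      dAction Us φ (perWin 4 (N * 2 ^ (k + 1))) = 0)
    (hcritU' : ∀ φ : Site 4 → Fin 4 → Matrix n n ℂ, IsSkewDir φ → IsPeriodicDir φ ((N * 2 ^ (k + 1) : ℕ) : ℤ) → TangentIter 2 k U' φ →
      dAction U' φ (perWin 4 (N * 2 ^ (k + 1))) = 0)
    {u : Site 4 → (Matrix n n ℂ)ˣ} {X₀ : Site 4 → Fin 4 → Matrix n n ℂ} {α₀ : ℝ} {m : Site 4 → Fin 4 → ℝ} {C : ℝ}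
    (hXs : IsSkewDir X₀)
    (hrep : ∀ (hWu : IsUnitaryCfg Us) (hx : 0 ≤ ε / ((((2 : ℕ) : ℝ)) ^ (k + 1)) ^ 2)
        (hs : LevelSmall 4 2 k (ε / ((((2 : ℕ) : ℝ)) ^ (k + 1)) ^ 2)) (hWx : SmallField Us (ε / ((((2 : ℕ) : ℝ)) ^ (k + 1)) ^ 2))
        (hθ : cruxC 4 2 * (((((2 : ℕ) : ℝ)) ^ (k + 1)) ^ 2 * (ε / ((((2 : ℕ) : ℝ)) ^ (k + 1)) ^ 2)) < 1)
        (hφ : IsSkewDir (dirIter 2 (k + 1) Us X₀)),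
      ResidualSliceRepT 2 N (k + 1) Us U' u X₀ (rightInvW (by norm_num) k hWu hx hs hWx N hθ hφ) α₀)
    (hm0 : ∀ z κ, 0 ≤ m z κ) (hC : 0 ≤ C)
    (hsq : ((((2 : ℕ) : ℝ)) ^ (k + 1)) ^ 4 * ∑ z ∈ periodBox (d := 4) N, ∑ κ : Fin 4, m z κ ^ 2
      ≤ C ^ 2 * dirSq X₀ (periodBox (d := 4) (N * 2 ^ (k + 1))))
    (hφq : ∀ z ∈ periodBox (d := 4) N, ∀ κ : Fin 4, ‖dirIter 2 (k + 1) Us X₀ z κ‖ ≤ C₂ * ((((2 : ℕ) : ℝ)) ^ (k + 1) * m z κ) ^ 2)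
    (hαh : α₀ * (((2 : ℕ) : ℝ)) ^ (k + 1) ≤ αh) (hmh : ∀ z κ, m z κ * (((2 : ℕ) : ℝ)) ^ (k + 1) ≤ αh) (hCh : C ≤ Ch)
    (hφq' : ∀ z ∈ periodBox (d := 4) N, ∀ κ : Fin 4, ‖dirIter 2 (k + 1) (gaugeAct u U') X₀ z κ‖ ≤ C₂ * ((((2 : ℕ) : ℝ)) ^ (k + 1) * m z κ) ^ 2)
    {r : ℝ} (hUsr : SmallField Us r) : SmallField U' r := by
  have hP0 := classSlicePoincare_SU2' (n := n) hn hN hε hε'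
  have hCP : 0 < CPLine 4 2 2 (1 / 10 ^ 17) (1 / 10 ^ 53) + 1 := by linarith [CPLine_nonneg_d4_L2]
  have hP : ∀ (j : ℕ) (W : Site 4 → Fin 4 → (Matrix n n ℂ)ˣ), W ∈ sfClass 4 2 N ε (j + 1) →
      SlicePoincare 2 (j + 1) W (frameFreeBlockLandauW 2 N (j + 1) W) (CPLine 4 2 2 (1 / 10 ^ 17) (1 / 10 ^ 53) + 1)
        (periodBox (d := 4) (N * 2 ^ (j + 1))) :=
    fun j W hW => slicePoincare_mono (hP0 j W hW) (by linarith)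
  have hls := levelSmall_all_d4_L2 hε.le (hε'.trans (by norm_num)) k
  have hε1 : ε ≤ 1 := hε'.trans (by norm_num)
  exact smallField_of_tanCritical_pair_routePi (d := 4) (by norm_num) k hε hls (thetaLoc_mul_lt_one hε hε') hε1 hC₂ hαh0 hαh1 hCh0 hCP hP hνh hκh hν
    hline hmem hU' hcritT hcritU' hXs hrep hm0 hC hsq hφq hαh hmh hCh hφq' hUsr

end

end Summit.QuantumFields.BalabanUV.T4Continuum.NE7CriticalPairSU2
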